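import Summits.BirchSwinnertonDyer.BirchSwinnertonDyer.Theses.CumulativeHeegnerLeopoldt
import HarnessLib

/-!
# Route `CumulativeHeegnerLeopoldt` — assembly item `Assembly` (stmt-BirchSwinnertonDyer-24203): the
# deciding theorem `closes`, curried

Seat `bsd-line-chl-p1` g0 (lead prover, cell `bsd-wall`, route `CumulativeHeegnerLeopoldt` rev 1). The item
`Assembly` is by construction `ToricPublishedInputs → LiuZhangZhangAdditiveInput → K1 → K2 → K3 → K4 → K5 → K6 →
LeopoldtKernelAtThree → WAllExclAddWildRankOne`, i.e. the route's planner-authored deciding theorem `closes`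
(which splits a wild rank-one row on the Leopoldt-cell predicate: on the cell the kernel, off it the residual K6)
with its binders as antecedents. HONEST FRAMING: pure logic; every crux, the kernel and the residuals remain
antecedents; BSD is not proved for any curve by this file.

References: [GrossZagier1986] Thm. I.(6.3) (the shape of the published inputs only).
-/

set_option linter.dupNamespace false
set_option autoImplicit false

namespace Summit.BirchSwinnertonDyer.BirchSwinnertonDyer.Theorems

open Summit.BirchSwinnertonDyer.BirchSwinnertonDyer.Theses.CumulativeHeegnerLeopoldt

/-- **Assembly (item 24203) of route `CumulativeHeegnerLeopoldt` holds**: published inputs → LZZ input →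
`CumulativeHeegnerInclusionAtThree` → `EisensteinCharacterInvariantsAtThree` → `WildSplitFrameAtThree` →
`RedSplitControlAtThree` → `WildRankZeroTwistAtThree` → `WildRankOneOffLeopoldtCellAtThree` →
`LeopoldtKernelAtThree` → the leaf `WAllExclAddWildRankOne` — the deciding theorem `closes`, curried.
[cite: GrossZagier1986, Thm. I.(6.3)] -/
theorem cumulativeHeegnerLeopoldt_assembly_proof : Assembly := by
  unfold Assembly
  -- (buildfix 2026-08-28) the route's `closes` was re-keyed (05:23Z) to `WildSplitPrintedInputsAtThree` /
  -- `LeopoldtKernelAtThreeOfPrint`; this CLOSED assembly keeps its accepted statement over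
  -- `WildSplitFrameAtThree` / `LeopoldtKernelAtThree`, so the pre-edit chain of `closes` is inlined (same
  -- Leopoldt-cell case split; the kernel is fed the frame item `h3`).
  intro hF hL h1 h2 h3 h4 h5 h6 hK W _ _ hCM hO6 hr
  by_cases hcell : (Literature.NumberTheory.EllipticCurves.Rank1Residual.Red W 3 ∧ (∃ Φ : AddSubgroup (WeierstrassCurve.geomTorsion W ((3 : ℕ) : ℤ)), Literature.NumberTheory.EllipticCurves.Rank1Residual.IsRationalLine W 3 Φ ∧ ∀ (v : IsDedekindDomain.HeightOneSpectrum (NumberField.RingOfIntegers ℚ)), ((3 : ℕ) : NumberField.RingOfIntegers ℚ) ∈ v.asIdeal → ∀ 𝔓 ∈ v.primesAbove, ¬ (∀ g ∈ 𝔓.decompositionSubgroup (Field.absoluteGaloisGroup ℚ), ∀ P ∈ Φ, g • P = P) ∧ ¬ (∀ g ∈ 𝔓.decompositionSubgroup (Field.absoluteGaloisGroup ℚ), ∀ P : WeierstrassCurve.geomTorsion W ((3 : ℕ) : ℤ), g • P - P ∈ Φ)))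
  · exact hK hF hL h1 h2 h3 h4 h5 W hCM hO6 hr hcell.1 hcell.2
  · exact h6 W hCM hO6 hr hcell

end Summit.BirchSwinnertonDyer.BirchSwinnertonDyer.Theorems
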